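import Literature.NumberTheory.GelbartRogawski1991.UnitaryDualPairSplittingDatum
import Literature.NumberTheory.Weil1964.ThetaDualPairDatum
import HarnessLib

-- buildfix G11b-3 recipe (LEDGER B13-1/B13-3): elaborate sequentially so the trailing `attribute [implicit_reducible]`
-- block (reducibilityCoreExt is keyed to the async environment branch) is in force at `.olean` export.
set_option Elab.async false

/-!
# Weil's theta-kernel datum of the unitary dual pair `U(J_V) × U(J_W)`, CONSTRUCTED from a compatible splitting

Topic `NumberTheory/GelbartRogawski1991`; namespace
`Literature.NumberTheory.GelbartRogawski1991.UnitaryDualPair` (continues `UnitaryDualPairSplittingDatum`).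

KERNEL JUNCTION (no new named fact).  `UnitaryDualPairSplittingDatum` packages, for a quadratic extension
`E/F` of number fields with `c ∈ Gal(E/F)`, hermitian Gram matrices `J_V = T_V ⊗ 1`, `J_W = T_W ⊗ 1`
(`T_V`, `T_W` symmetric invertible over `F`) and an enumeration `e : Fin N × Fin M ≃ Fin n`, the
`GelbartRogawski1991.SplittingDatum` of the seesaw embedding
`ι : U(J_V ⊗ J_W)(𝔸_F) ↪ Sp(𝕎_𝔸)`, `𝕎 = Res_{E/F}(V ⊗ W)`, over Weil's continuous adelic metaplectic group
`Mp_ψ(𝕎_𝔸)ᶜᵒⁿᵗ = adelicMpCont F (Fin n) (adelicGram F e T_V T_W)`, and — from a compatible splitting `s`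
([GelbartRogawski1991, Prop. 3.1.1], the named fact `SplittingDatum.CompatibleSplitting`, NOT restated here) —
the PAIR SPLITTING `s_pair : U(J_V)(𝔸_F) × U(J_W)(𝔸_F) →* Mp_ψ(𝕎_𝔸)ᶜᵒⁿᵗ`.

This file composes `s_pair` with the Weil representation `ω_ψ` (`adelicMpCont.omega`) and feeds the result to
`Weil1964.ThetaKernelDatum.adelicOfDualPairRep`: the outcome is Weil's THETA-KERNEL DATUM of the unitary dual
pair ([Weil1964, n° 41 Thm 6]; [GelbartRogawski1991, §3.2]: `θ_Φ(g, h) = Σ_ξ (ω_ψ(s(g, h))Φ)(ξ)`),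
as a `ThetaKernelDatum` over the adelic carriers `UnitaryGroup.adelic F E c N J_V`, `UnitaryGroup.adelic F E c M J_W`
with rational lattices `U(J_V)(F) = (UnitaryGroup.toAdelic …).range`, `U(J_W)(F)`.

Inputs that remain HYPOTHESES of the construction (each discharged elsewhere, none minted here):
* `hs : (splittingDatum …).IsCompatible s` — an instance of [GelbartRogawski1991, Prop. 3.1.1]
  (`SplittingDatum.CompatibleSplitting`, existential; the `…OfCompatibleSplitting` forms below choose `s`);
* `hρ : HasThetaMajorants (fun p Φ => ω_ψ(s_pair p) Φ)` — Weil's Lemme 5 in M-test form for the pulled-back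
  representation ([Weil1964, n° 41 Lemme 5 p. 191]; supplied by `Weil1964.AdelicMetaplecticThetaMajorants`);
* `SK`, `hSK` — a `U(J_W)(𝔸_F)`-stable set of Schwartz–Bruhat functions (the consumer's choice, e.g. a
  `K_∞`-isotypic subspace; `Set.univ` is allowed);
* `[LocallyCompactSpace (UnitaryGroup.adelic F E c N J_V)]`, `[… J_W]` — instance binders in the generic
  currency (for a CM field `L/L⁺` they are `Automorphic.AdelicUnitaryGroup`'s instances, the carriers being
  definitionally `adelicUnitaryGroup L J`).

Main definitions / results (all kernel-checked, `rfl` API):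
* `pairRep s : Representation ℂ (U(J_V)(𝔸) × U(J_W)(𝔸)) 𝒮(𝕎_𝔸) := ω_ψ ∘ s_pair`;
* `pairRep_toHomUnits_mem_thetaStabilizer` — for a compatible `s`, `ω_ψ(s_pair(γ_U, γ))` fixes `Θ` for all
  rational `γ_U`, `γ` (Weil's Thm 6 transported through [GelbartRogawski1991, (3.1.1)–(3.1.2)]);
* `thetaKernelDatum s hs hρ SK hSK` — THE CONSTRUCTED DATUM; `thetaKernelDatum_s = MonoidHom.id`,
  `thetaKernelDatum_act`, `thetaKernelDatum_SK`, `thetaKernelDatum_thetaFun_mk`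
  (`θ_Φ(x, h) = Θ(ω_ψ(s_pair(x⁻¹, h⁻¹))Φ)`), `continuous_thetaKernelDatum_thetaFun`,
  `thetaKernelDatum_thetaFun_mul_right` (right `U(J_V)(F) × U(J_W)(F)`-invariance);
* `thetaKernelDatumOfCompatibleSplitting hGR …` — the same with `s := hGR.choose`,
  `hGR : (splittingDatum …).CompatibleSplitting`, and `continuous_pairSplitting_choose`.

References: A. Weil, Acta Math. 111 (1964) 143–211, Chap. III n° 41 [Weil1964]; S. Gelbart, J. Rogawski,
Invent. Math. 105 (1991) 445–472, §3.1–3.2 pp. 454–457 [GelbartRogawski1991]; S. Kudla, Israel J. Math. 87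
(1994) §3 [Kudla1994].
-/

noncomputable section

open scoped Matrix Kronecker
open NumberField
open Literature.RepresentationTheory.HeisenbergGroup
open Literature.NumberTheory.Automorphic
open Literature.NumberTheory.Weil1964

namespace Literature.NumberTheory.GelbartRogawski1991

namespace UnitaryDualPair

section PairRep

variable (F E : Type) [Field F] [NumberField F] [Field E] [NumberField E] [Algebra F E]
variable (c : E ≃ₐ[F] E) (N M : ℕ) {n : ℕ} (e : Fin N × Fin M ≃ Fin n)
variable (JV : Matrix (Fin N) (Fin N) E) (JW : Matrix (Fin M) (Fin M) E)
variable {TV : Matrix (Fin N) (Fin N) F} {TW : Matrix (Fin M) (Fin M) F}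

/-- **`ω_ψ ∘ s_pair`**: the Weil representation of `Mp_ψ(𝕎_𝔸)ᶜᵒⁿᵗ` pulled back along the pair splitting, as a
representation of `U(J_V)(𝔸_F) × U(J_W)(𝔸_F)` on `𝒮(𝕎_𝔸)` (the representation whose theta series is the kernel of
[GelbartRogawski1991, §3.2]). [cite: Weil1964, Chap. III n° 41 p. 193] -/
def pairRep (s : UnitaryGroup.adelicPair F E c N M JV JW →* adelicMpCont F (Fin n) (adelicGram F e TV TW)) :
    Representation ℂ (UnitaryGroup.adelic F E c N JV × UnitaryGroup.adelic F E c M JW) (piSchwartzBruhat F (Fin n)) :=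
  (adelicMpCont.omega F (Fin n) (adelicGram F e TV TW)).comp (pairSplitting F E c N M e JV JW s)

/-- `(ω_ψ ∘ s_pair)(p) Φ = ω_ψ(s_pair p) Φ`. [folklore] -/
@[simp] theorem pairRep_apply (s : UnitaryGroup.adelicPair F E c N M JV JW →* adelicMpCont F (Fin n) (adelicGram F e TV TW))
    (p : UnitaryGroup.adelic F E c N JV × UnitaryGroup.adelic F E c M JW) (Φ : piSchwartzBruhat F (Fin n)) :
    pairRep F E c N M e JV JW s p Φ =
      adelicMpCont.omega F (Fin n) (adelicGram F e TV TW) (pairSplitting F E c N M e JV JW s p) Φ := rfl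

/-- `(ω_ψ ∘ s_pair).toHomUnits = (ω_ψ.comp s_pair).toHomUnits` (the spelling of `UnitaryDualPairSplittingDatum`).
[folklore] -/
theorem pairRep_toHomUnits (s : UnitaryGroup.adelicPair F E c N M JV JW →* adelicMpCont F (Fin n) (adelicGram F e TV TW)) :
    (pairRep F E c N M e JV JW s).toHomUnits =
      ((adelicMpCont.omega F (Fin n) (adelicGram F e TV TW)).comp (pairSplitting F E c N M e JV JW s)).toHomUnits := rfl

/-- `s_pair` is continuous as soon as `s` is (`adelicInl`, `adelicInr` are continuous). [folklore] -/
theorem continuous_pairSplitting {s : UnitaryGroup.adelicPair F E c N M JV JW →* adelicMpCont F (Fin n) (adelicGram F e TV TW)}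
    (hsc : Continuous s) : Continuous (pairSplitting F E c N M e JV JW s) :=
  SplittingDatum.continuous_pair hsc (UnitaryGroup.continuous_adelicInl F E c N M JV JW)
    (UnitaryGroup.continuous_adelicInr F E c N M JV JW) _

variable [Algebra.IsQuadraticExtension F E] {δ : E} (hcδ : c δ = -δ) (hδ : δ ≠ 0) {d : F}
  (hd : δ * δ = algebraMap F E d) (hV : TV.IsSymm) (hW : TW.IsSymm) (hVd : IsUnit TV.det) (hWd : IsUnit TW.det)
  (hJV : JV = TV.map (algebraMap F E)) (hJW : JW = TW.map (algebraMap F E))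

/-- **`π(s_pair(x, y)) = ι(x ⊗ 1 · 1 ⊗ y)`** for a compatible splitting. [cite: GelbartRogawski1991, §3.1
Prop. 3.1.1 p. 455 L1–3] -/
theorem proj_pairSplitting {s : UnitaryGroup.adelicPair F E c N M JV JW →* adelicMpCont F (Fin n) (adelicGram F e TV TW)}
    (hs : (splittingDatum F E c N M e JV JW hcδ hδ hd hV hW hVd hWd hJV hJW).IsCompatible s)
    (p : UnitaryGroup.adelic F E c N JV × UnitaryGroup.adelic F E c M JW) :
    adelicMpCont.proj F (Fin n) (adelicGram F e TV TW) (pairSplitting F E c N M e JV JW s p) =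
      toSp F E c N M e JV JW hcδ hδ hd hV hW hJV hJW
        (UnitaryGroup.adelicInl F E c N M JV JW p.1 * UnitaryGroup.adelicInr F E c N M JV JW p.2) :=
  hs.1 _

/-- **Weil's Théorème 6 for the unitary dual pair**: for a COMPATIBLE splitting `s`
([GelbartRogawski1991, (3.1.1)–(3.1.2)]) the operator `ω_ψ(s_pair(γ_U, γ))` fixes the theta distribution `Θ`
for all rational `γ_U ∈ U(J_V)(F)`, `γ ∈ U(J_W)(F)` — since `s(γ_U ⊗ γ) = i(γ_U ⊗ γ)` with `i = r_F` Weil's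
`Θ`-fixing section over `Sp_F(𝕎)`. This is the input `hrat` of `Weil1964.ThetaKernelDatum.adelicOfDualPairRep`.
[cite: Weil1964, Chap. III n° 41 Thm 6 p. 193; GelbartRogawski1991, §3.1 Prop. 3.1.1 p. 455 L1–3] -/
theorem pairRep_toHomUnits_mem_thetaStabilizer
    {s : UnitaryGroup.adelicPair F E c N M JV JW →* adelicMpCont F (Fin n) (adelicGram F e TV TW)}
    (hs : (splittingDatum F E c N M e JV JW hcδ hδ hd hV hW hVd hWd hJV hJW).IsCompatible s)
    {γU : UnitaryGroup.adelic F E c N JV} (hγU : γU ∈ (UnitaryGroup.toAdelic F E c N JV).range)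
    {γ : UnitaryGroup.adelic F E c M JW} (hγ : γ ∈ (UnitaryGroup.toAdelic F E c M JW).range) :
    (pairRep F E c N M e JV JW s).toHomUnits (γU, γ) ∈ thetaStabilizer F (Fin n) := by
  have ha : ∀ γ ∈ (UnitaryGroup.toAdelic F E c N JV).range, UnitaryGroup.adelicInl F E c N M JV JW γ ∈
      (splittingDatum F E c N M e JV JW hcδ hδ hd hV hW hVd hWd hJV hJW).ratPts := by
    rintro _ ⟨γ, rfl⟩
    exact UnitaryGroup.adelicInl_toAdelic_mem_range F E c N M JV JW γ
  have hb : ∀ γ ∈ (UnitaryGroup.toAdelic F E c M JW).range, UnitaryGroup.adelicInr F E c N M JV JW γ ∈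
      (splittingDatum F E c N M e JV JW hcδ hδ hd hV hW hVd hWd hJV hJW).ratPts := by
    rintro _ ⟨γ, rfl⟩
    exact UnitaryGroup.adelicInr_toAdelic_mem_range F E c N M JV JW γ
  have hmem := hs.pair_mem _ _ (UnitaryGroup.commute_adelicInl_adelicInr F E c N M JV JW) ha hb
    (T := (thetaStabilizer F (Fin n)).toSubmonoid.comap
      (adelicMpCont.omega F (Fin n) (adelicGram F e TV TW)).toHomUnits)
    (fun x => omega_ratSplit_mem_thetaStabilizer F E c N M e JV JW hcδ hδ hd hV hW hVd hWd hJV hJW x) γU hγU γ hγ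
  exact (mem_thetaStabilizer_iff _).2 fun Φ => (mem_thetaStabilizer_iff _).1 hmem Φ

/-- … unfolded: `Θ(ω_ψ(s_pair(γ_U, γ)) Φ) = Θ(Φ)`. [cite: Weil1964, Chap. III n° 41 Thm 6 p. 193] -/
theorem thetaDistLM_pairRep_rat
    {s : UnitaryGroup.adelicPair F E c N M JV JW →* adelicMpCont F (Fin n) (adelicGram F e TV TW)}
    (hs : (splittingDatum F E c N M e JV JW hcδ hδ hd hV hW hVd hWd hJV hJW).IsCompatible s)
    {γU : UnitaryGroup.adelic F E c N JV} (hγU : γU ∈ (UnitaryGroup.toAdelic F E c N JV).range)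
    {γ : UnitaryGroup.adelic F E c M JW} (hγ : γ ∈ (UnitaryGroup.toAdelic F E c M JW).range)
    (Φ : piSchwartzBruhat F (Fin n)) :
    thetaDistLM F (Fin n) (pairRep F E c N M e JV JW s (γU, γ) Φ) = thetaDistLM F (Fin n) Φ :=
  (mem_thetaStabilizer_iff _).1
    (pairRep_toHomUnits_mem_thetaStabilizer F E c N M e JV JW hcδ hδ hd hV hW hVd hWd hJV hJW hs hγU hγ) Φ

end PairRep

/-! ## The constructed theta-kernel datum -/

section Kernel

variable (F E : Type) [Field F] [NumberField F] [Field E] [NumberField E] [Algebra F E]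
variable (c : E ≃ₐ[F] E) (N M : ℕ) {n : ℕ} (e : Fin N × Fin M ≃ Fin n)
variable (JV : Matrix (Fin N) (Fin N) E) (JW : Matrix (Fin M) (Fin M) E)
variable {TV : Matrix (Fin N) (Fin N) F} {TW : Matrix (Fin M) (Fin M) F}
variable [Algebra.IsQuadraticExtension F E] {δ : E} (hcδ : c δ = -δ) (hδ : δ ≠ 0) {d : F}
  (hd : δ * δ = algebraMap F E d) (hV : TV.IsSymm) (hW : TW.IsSymm) (hVd : IsUnit TV.det) (hWd : IsUnit TW.det)
  (hJV : JV = TV.map (algebraMap F E)) (hJW : JW = TW.map (algebraMap F E))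
variable [LocallyCompactSpace (UnitaryGroup.adelic F E c N JV)] [LocallyCompactSpace (UnitaryGroup.adelic F E c M JW)]

/-- **THE THETA-KERNEL DATUM OF THE UNITARY DUAL PAIR `U(J_V) × U(J_W)`, CONSTRUCTED** (Weil's datum
`adelicOfDualPairRep` at `ω := ω_ψ ∘ s_pair`): Heisenberg–Weil datum `repWeilThetaDatum F (Fin n) (ω_ψ ∘ s_pair)`,
`s = id`, `S_K := SK`, `Θ(S) := Θ_𝔸 ∘ S⁻¹`, kernel `θ_Φ(x, h) = Θ(ω_ψ(s_pair(x⁻¹, h⁻¹))Φ)`; hypotheses: a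
compatible splitting `s` ([GelbartRogawski1991, Prop. 3.1.1]), Weil's majorants for `ω_ψ ∘ s_pair`
([Weil1964, Lemme 5]) and an `U(J_W)(𝔸)`-stable `SK`; its theta series is the kernel of [GelbartRogawski1991, §3.2].
[cite: Weil1964, Chap. III n° 41 Thm 6 p. 193] -/
def thetaKernelDatum
    (s : UnitaryGroup.adelicPair F E c N M JV JW →* adelicMpCont F (Fin n) (adelicGram F e TV TW))
    (hs : (splittingDatum F E c N M e JV JW hcδ hδ hd hV hW hVd hWd hJV hJW).IsCompatible s)
    (hρ : HasThetaMajorants fun (p : UnitaryGroup.adelic F E c N JV × UnitaryGroup.adelic F E c M JW)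
      (Φ : piSchwartzBruhat F (Fin n)) => pairRep F E c N M e JV JW s p Φ)
    (SK : Set (piSchwartzBruhat F (Fin n)))
    (hSK : ∀ (h : UnitaryGroup.adelic F E c M JW) (Φ : piSchwartzBruhat F (Fin n)), Φ ∈ SK →
      pairRep F E c N M e JV JW s (1, h) Φ ∈ SK) :
    ThetaKernelDatum (UnitaryGroup.adelic F E c N JV × UnitaryGroup.adelic F E c M JW)
      (repWeilThetaDatum F (Fin n) (pairRep F E c N M e JV JW s).toHomUnits
        ((((UnitaryGroup.toAdelic F E c N JV).range).prod (UnitaryGroup.toAdelic F E c M JW).range :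
            Subgroup (UnitaryGroup.adelic F E c N JV × UnitaryGroup.adelic F E c M JW)) :
          Set (UnitaryGroup.adelic F E c N JV × UnitaryGroup.adelic F E c M JW))).ThetaTop
      (UnitaryGroup.adelic F E c N JV) (UnitaryGroup.toAdelic F E c N JV).range
      (UnitaryGroup.adelic F E c M JW) (UnitaryGroup.toAdelic F E c M JW).range :=
  ThetaKernelDatum.adelicOfDualPairRep (ΓU := (UnitaryGroup.toAdelic F E c N JV).range)
    (Γ := (UnitaryGroup.toAdelic F E c M JW).range) (pairRep F E c N M e JV JW s) hρ
    (fun _ hγU _ hγ =>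
      pairRep_toHomUnits_mem_thetaStabilizer F E c N M e JV JW hcδ hδ hd hV hW hVd hWd hJV hJW hs hγU hγ)
    SK hSK

variable {s : UnitaryGroup.adelicPair F E c N M JV JW →* adelicMpCont F (Fin n) (adelicGram F e TV TW)}
  (hs : (splittingDatum F E c N M e JV JW hcδ hδ hd hV hW hVd hWd hJV hJW).IsCompatible s)
  (hρ : HasThetaMajorants fun (p : UnitaryGroup.adelic F E c N JV × UnitaryGroup.adelic F E c M JW)
    (Φ : piSchwartzBruhat F (Fin n)) => pairRep F E c N M e JV JW s p Φ)
  (SK : Set (piSchwartzBruhat F (Fin n)))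
  (hSK : ∀ (h : UnitaryGroup.adelic F E c M JW) (Φ : piSchwartzBruhat F (Fin n)), Φ ∈ SK →
    pairRep F E c N M e JV JW s (1, h) Φ ∈ SK)

/-- the lift `s` of the constructed datum is the identity of `U(J_V)(𝔸) × U(J_W)(𝔸)` (the splitting is inside
`ω_ψ ∘ s_pair`). [folklore] -/
theorem thetaKernelDatum_s :
    (thetaKernelDatum F E c N M e JV JW hcδ hδ hd hV hW hVd hWd hJV hJW s hs hρ SK hSK).s = MonoidHom.id _ := rfl

/-- the Weil action of the constructed datum: `W.act p Φ = ω_ψ(s_pair p) Φ`. [cite: Weil1964, Chap. III n° 41 p. 193] -/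
theorem thetaKernelDatum_act (p : UnitaryGroup.adelic F E c N JV × UnitaryGroup.adelic F E c M JW)
    (Φ : piSchwartzBruhat F (Fin n)) :
    (thetaKernelDatum F E c N M e JV JW hcδ hδ hd hV hW hVd hWd hJV hJW s hs hρ SK hSK).W.act p Φ =
      adelicMpCont.omega F (Fin n) (adelicGram F e TV TW) (pairSplitting F E c N M e JV JW s p) Φ := rfl

/-- … along the datum's own lift: `W.act (s p) Φ = ω_ψ(s_pair p) Φ`. [folklore] -/
theorem thetaKernelDatum_act_s (p : UnitaryGroup.adelic F E c N JV × UnitaryGroup.adelic F E c M JW)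
    (Φ : piSchwartzBruhat F (Fin n)) :
    (thetaKernelDatum F E c N M e JV JW hcδ hδ hd hV hW hVd hWd hJV hJW s hs hρ SK hSK).W.act
        ((thetaKernelDatum F E c N M e JV JW hcδ hδ hd hV hW hVd hWd hJV hJW s hs hρ SK hSK).s p) Φ =
      adelicMpCont.omega F (Fin n) (adelicGram F e TV TW) (pairSplitting F E c N M e JV JW s p) Φ := rfl

/-- the `K`-type set of the constructed datum is the given `SK`. [folklore] -/
theorem thetaKernelDatum_SK :
    (thetaKernelDatum F E c N M e JV JW hcδ hδ hd hV hW hVd hWd hJV hJW s hs hρ SK hSK).SK = SK := rfl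

/-- **the theta kernel of the unitary dual pair**: `θ_Φ(x, h) = Θ(ω_ψ(s_pair(x⁻¹, h⁻¹)) Φ)`.
[cite: Weil1964, Chap. III n° 41 Thm 6 p. 193] -/
theorem thetaKernelDatum_thetaFun_mk (Φ : piSchwartzBruhat F (Fin n)) (x : UnitaryGroup.adelic F E c N JV)
    (h : UnitaryGroup.adelic F E c M JW) :
    (thetaKernelDatum F E c N M e JV JW hcδ hδ hd hV hW hVd hWd hJV hJW s hs hρ SK hSK).thetaFun Φ (x, h) =
      thetaDistLM F (Fin n)
        (adelicMpCont.omega F (Fin n) (adelicGram F e TV TW) (pairSplitting F E c N M e JV JW s (x⁻¹, h⁻¹)) Φ) := rfl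

/-- … as a series over the rational points of `𝕎`: `θ_Φ(x, h) = Σ_{ξ ∈ F^n} (ω_ψ(s_pair(x⁻¹, h⁻¹))Φ)(ξ)`.
[cite: Weil1964, Chap. III n° 41, p. 193] -/
theorem thetaKernelDatum_thetaFun_mk_eq_tsum (Φ : piSchwartzBruhat F (Fin n)) (x : UnitaryGroup.adelic F E c N JV)
    (h : UnitaryGroup.adelic F E c M JW) :
    (thetaKernelDatum F E c N M e JV JW hcδ hδ hd hV hW hVd hWd hJV hJW s hs hρ SK hSK).thetaFun Φ (x, h) =
      ∑' ξ : Fin n → F,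
        ((adelicMpCont.omega F (Fin n) (adelicGram F e TV TW) (pairSplitting F E c N M e JV JW s (x⁻¹, h⁻¹)) Φ :
            piSchwartzBruhat F (Fin n)) : (Fin n → AdeleRing (𝓞 F) F) → ℂ) (ratPt F (Fin n) ξ) := rfl

/-- the theta kernel is continuous in `(x, h)`. [folklore] -/
theorem continuous_thetaKernelDatum_thetaFun (Φ : piSchwartzBruhat F (Fin n)) :
    Continuous ((thetaKernelDatum F E c N M e JV JW hcδ hδ hd hV hW hVd hWd hJV hJW s hs hρ SK hSK).thetaFun Φ) :=
  (thetaKernelDatum F E c N M e JV JW hcδ hδ hd hV hW hVd hWd hJV hJW s hs hρ SK hSK).continuous_thetaFun Φ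

/-- the theta kernel is right-invariant under the rational points `U(J_V)(F) × U(J_W)(F)`. [cite: Weil1964,
Chap. III n° 41 Thm 6 p. 193] -/
theorem thetaKernelDatum_thetaFun_mul_right (Φ : piSchwartzBruhat F (Fin n))
    (p : UnitaryGroup.adelic F E c N JV × UnitaryGroup.adelic F E c M JW)
    {γU : UnitaryGroup.adelic F E c N JV} (hγU : γU ∈ (UnitaryGroup.toAdelic F E c N JV).range)
    {γ : UnitaryGroup.adelic F E c M JW} (hγ : γ ∈ (UnitaryGroup.toAdelic F E c M JW).range) :
    (thetaKernelDatum F E c N M e JV JW hcδ hδ hd hV hW hVd hWd hJV hJW s hs hρ SK hSK).thetaFun Φ (p * (γU, γ)) =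
      (thetaKernelDatum F E c N M e JV JW hcδ hδ hd hV hW hVd hWd hJV hJW s hs hρ SK hSK).thetaFun Φ p :=
  (thetaKernelDatum F E c N M e JV JW hcδ hδ hd hV hW hVd hWd hJV hJW s hs hρ SK hSK).thetaFun_mul_right Φ p hγU hγ

end Kernel

/-! ## From the existential form `CompatibleSplitting` ([GelbartRogawski1991, Prop. 3.1.1] as cited) -/

section OfCompatibleSplitting

variable (F E : Type) [Field F] [NumberField F] [Field E] [NumberField E] [Algebra F E]
variable (c : E ≃ₐ[F] E) (N M : ℕ) {n : ℕ} (e : Fin N × Fin M ≃ Fin n)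
variable (JV : Matrix (Fin N) (Fin N) E) (JW : Matrix (Fin M) (Fin M) E)
variable {TV : Matrix (Fin N) (Fin N) F} {TW : Matrix (Fin M) (Fin M) F}
variable [Algebra.IsQuadraticExtension F E] {δ : E} (hcδ : c δ = -δ) (hδ : δ ≠ 0) {d : F}
  (hd : δ * δ = algebraMap F E d) (hV : TV.IsSymm) (hW : TW.IsSymm) (hVd : IsUnit TV.det) (hWd : IsUnit TW.det)
  (hJV : JV = TV.map (algebraMap F E)) (hJW : JW = TW.map (algebraMap F E))

/-- **a compatible splitting, CHOSEN** from the cited existential `CompatibleSplitting`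
([GelbartRogawski1991, Prop. 3.1.1]; `Exists.choose`). [cite: GelbartRogawski1991, §3.1 Prop. 3.1.1 p. 455 L1–3] -/
def splittingOf (hGR : (splittingDatum F E c N M e JV JW hcδ hδ hd hV hW hVd hWd hJV hJW).CompatibleSplitting) :
    UnitaryGroup.adelicPair F E c N M JV JW →* adelicMpCont F (Fin n) (adelicGram F e TV TW) :=
  hGR.choose

/-- the chosen splitting is continuous. [cite: GelbartRogawski1991, §3.1 Prop. 3.1.1 p. 455 L1–3] -/
theorem continuous_splittingOf
    (hGR : (splittingDatum F E c N M e JV JW hcδ hδ hd hV hW hVd hWd hJV hJW).CompatibleSplitting) :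
    Continuous (splittingOf F E c N M e JV JW hcδ hδ hd hV hW hVd hWd hJV hJW hGR) :=
  hGR.choose_spec.1

/-- the chosen splitting is compatible ((3.1.1)–(3.1.2)). [cite: GelbartRogawski1991, §3.1 Prop. 3.1.1 p. 455 L1–3] -/
theorem splittingOf_isCompatible
    (hGR : (splittingDatum F E c N M e JV JW hcδ hδ hd hV hW hVd hWd hJV hJW).CompatibleSplitting) :
    (splittingDatum F E c N M e JV JW hcδ hδ hd hV hW hVd hWd hJV hJW).IsCompatible
      (splittingOf F E c N M e JV JW hcδ hδ hd hV hW hVd hWd hJV hJW hGR) :=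
  hGR.choose_spec.2

/-- the pair splitting of the chosen splitting is continuous (input `hs` of
`Weil1964.AdelicMetaplecticThetaMajorants`). [cite: GelbartRogawski1991, §3.1 Prop. 3.1.1 p. 455 L1–3] -/
theorem continuous_pairSplitting_splittingOf
    (hGR : (splittingDatum F E c N M e JV JW hcδ hδ hd hV hW hVd hWd hJV hJW).CompatibleSplitting) :
    Continuous (pairSplitting F E c N M e JV JW (splittingOf F E c N M e JV JW hcδ hδ hd hV hW hVd hWd hJV hJW hGR)) :=
  continuous_pairSplitting F E c N M e JV JW (continuous_splittingOf F E c N M e JV JW hcδ hδ hd hV hW hVd hWd hJV hJW hGR)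

/-- `π(s_pair(x, y)) = ι(x ⊗ 1 · 1 ⊗ y)` for the chosen splitting (input `(w2)`-side projection formula).
[cite: GelbartRogawski1991, §3.1 Prop. 3.1.1 p. 455 L1–3] -/
theorem proj_pairSplitting_splittingOf
    (hGR : (splittingDatum F E c N M e JV JW hcδ hδ hd hV hW hVd hWd hJV hJW).CompatibleSplitting)
    (p : UnitaryGroup.adelic F E c N JV × UnitaryGroup.adelic F E c M JW) :
    adelicMpCont.proj F (Fin n) (adelicGram F e TV TW)
        (pairSplitting F E c N M e JV JW (splittingOf F E c N M e JV JW hcδ hδ hd hV hW hVd hWd hJV hJW hGR) p) =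
      toSp F E c N M e JV JW hcδ hδ hd hV hW hJV hJW
        (UnitaryGroup.adelicInl F E c N M JV JW p.1 * UnitaryGroup.adelicInr F E c N M JV JW p.2) :=
  proj_pairSplitting F E c N M e JV JW hcδ hδ hd hV hW hVd hWd hJV hJW
    (splittingOf_isCompatible F E c N M e JV JW hcδ hδ hd hV hW hVd hWd hJV hJW hGR) p

variable [LocallyCompactSpace (UnitaryGroup.adelic F E c N JV)] [LocallyCompactSpace (UnitaryGroup.adelic F E c M JW)]

/-- **THE THETA-KERNEL DATUM OF `U(J_V) × U(J_W)` from [GelbartRogawski1991, Prop. 3.1.1] as cited**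
(`s := splittingOf hGR`). [cite: Weil1964, Chap. III n° 41 Thm 6 p. 193] -/
def thetaKernelDatumOfCompatibleSplitting
    (hGR : (splittingDatum F E c N M e JV JW hcδ hδ hd hV hW hVd hWd hJV hJW).CompatibleSplitting)
    (hρ : HasThetaMajorants fun (p : UnitaryGroup.adelic F E c N JV × UnitaryGroup.adelic F E c M JW)
      (Φ : piSchwartzBruhat F (Fin n)) =>
        pairRep F E c N M e JV JW (splittingOf F E c N M e JV JW hcδ hδ hd hV hW hVd hWd hJV hJW hGR) p Φ)
    (SK : Set (piSchwartzBruhat F (Fin n)))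
    (hSK : ∀ (h : UnitaryGroup.adelic F E c M JW) (Φ : piSchwartzBruhat F (Fin n)), Φ ∈ SK →
      pairRep F E c N M e JV JW (splittingOf F E c N M e JV JW hcδ hδ hd hV hW hVd hWd hJV hJW hGR) (1, h) Φ ∈ SK) :=
  thetaKernelDatum F E c N M e JV JW hcδ hδ hd hV hW hVd hWd hJV hJW
    (splittingOf F E c N M e JV JW hcδ hδ hd hV hW hVd hWd hJV hJW hGR)
    (splittingOf_isCompatible F E c N M e JV JW hcδ hδ hd hV hW hVd hWd hJV hJW hGR) hρ SK hSK

/-- its theta kernel: `θ_Φ(x, h) = Θ(ω_ψ(s_pair(x⁻¹, h⁻¹)) Φ)` with `s` the chosen compatible splitting.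
[cite: Weil1964, Chap. III n° 41 Thm 6 p. 193] -/
theorem thetaKernelDatumOfCompatibleSplitting_thetaFun_mk
    (hGR : (splittingDatum F E c N M e JV JW hcδ hδ hd hV hW hVd hWd hJV hJW).CompatibleSplitting)
    (hρ : HasThetaMajorants fun (p : UnitaryGroup.adelic F E c N JV × UnitaryGroup.adelic F E c M JW)
      (Φ : piSchwartzBruhat F (Fin n)) =>
        pairRep F E c N M e JV JW (splittingOf F E c N M e JV JW hcδ hδ hd hV hW hVd hWd hJV hJW hGR) p Φ)
    (SK : Set (piSchwartzBruhat F (Fin n)))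
    (hSK : ∀ (h : UnitaryGroup.adelic F E c M JW) (Φ : piSchwartzBruhat F (Fin n)), Φ ∈ SK →
      pairRep F E c N M e JV JW (splittingOf F E c N M e JV JW hcδ hδ hd hV hW hVd hWd hJV hJW hGR) (1, h) Φ ∈ SK)
    (Φ : piSchwartzBruhat F (Fin n)) (x : UnitaryGroup.adelic F E c N JV) (h : UnitaryGroup.adelic F E c M JW) :
    (thetaKernelDatumOfCompatibleSplitting F E c N M e JV JW hcδ hδ hd hV hW hVd hWd hJV hJW hGR hρ SK hSK).thetaFun
        Φ (x, h) =
      thetaDistLM F (Fin n)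
        (adelicMpCont.omega F (Fin n) (adelicGram F e TV TW)
          (pairSplitting F E c N M e JV JW (splittingOf F E c N M e JV JW hcδ hδ hd hV hW hVd hWd hJV hJW hGR)
            (x⁻¹, h⁻¹)) Φ) := rfl

end OfCompatibleSplitting

/-! ### Build-lane note (ops-buildfix G11b-3 recipe, LEDGER B13-1, 2026-08-21)
`lean -o` (the hub build lane, never `lean`/the gate check) runs Lean 4.32's library-suggestion indexers
(`Lean.LibrarySuggestions.SymbolFrequency` / `SineQuaNon`, from their `exportEntriesFn`) over the statement of
every local theorem that is not a denied premise; on this family's statements (very large dependent binder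
telescopes through the theta-kernel / dual-pair data) that fold runs for tens of minutes to hours and the build
lane kills the job (incident G11b-3, run/shared/lean/ops/buildfix/G11b-3-DOSSIER.md). `isDeniedPremise` skips
`[implicit_reducible]` constants before any fold, and a reducibility status on a *theorem* is inert (Meta never
unfolds `thmInfo`; the kernel ignores the attribute), so the public theorems of this file are tagged
`[implicit_reducible]` purely to keep them out of that index. Only other effect: they are not offered by
`+suggestions` premise selectors. No statement or proof is changed; superseded if the operator lands a
deny-list form (`HarnessLib.PremiseIndex`). -/
set_option allowUnsafeReducibility true in
attribute [implicit_reducible]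
  pairRep_apply pairRep_toHomUnits continuous_pairSplitting proj_pairSplitting
  pairRep_toHomUnits_mem_thetaStabilizer thetaDistLM_pairRep_rat thetaKernelDatum_s
  thetaKernelDatum_act thetaKernelDatum_act_s thetaKernelDatum_SK thetaKernelDatum_thetaFun_mk
  thetaKernelDatum_thetaFun_mk_eq_tsum continuous_thetaKernelDatum_thetaFun
  thetaKernelDatum_thetaFun_mul_right continuous_splittingOf splittingOf_isCompatible
  continuous_pairSplitting_splittingOf proj_pairSplitting_splittingOf
  thetaKernelDatumOfCompatibleSplitting_thetaFun_mk

end UnitaryDualPair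

end Literature.NumberTheory.GelbartRogawski1991

end
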